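import Summits.CriticalPhenomena.PercolationContinuityZ3.Theorems.PercNearOneGluingNoHeavyLowerTailSunflowerOneAllowance
import HarnessLib

/-!
# `NoHeavyLowerTail` (crux stmt-CriticalPhenomena-4575), abstract sunflower cubic: the capped pendant lemma WITH ONE ALLOWANCE —
# part 1, the normalised bound

Support file (seat `prim-ineq-prove-1` gen 62; `--supports stmt-CriticalPhenomena-4575`).  No `sorry`, no named facts.
Memo: run/shared/lean/prim/prim-ineq-prove-1/FINDING-CPL-prove1-g61.md §5.1 (the plan) and FINDING-TBERN-prove1-g62.md §1.

This is the assembly announced in `…SunflowerOneAllowance`: the pendant proof (`Pendant.normalised_bound`: normalise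
`x = u/b`, `y = g/a₀`, `z = vv/β`; split the petals into the `u`-heavy class `P` (`y ≤ x`) and the `g`-heavy class `Q` (`x < y`); merge
both classes with `prod_pfun_le_merged(')`, link-merge `Q` with `prod_lfun_le`) with the final step `Pendant.final_two` replaced by
`LinkedCurrency.one_allowance_final`, whose extra hypothesis `a₀·Y_P·Z_Q ≤ V` follows from the `z`-budget as soon as the merged
`u`-heavy class satisfies the single-petal link `a₀Y_P ≤ βZ_P` ("one allowance").  That holds whenever every petal but at most one
has `y_j ≤ z_j`, i.e. `β·g_j ≤ a₀·vv_j` (the exceptional petal still has `a₀y ≤ βz` from `m ≤ vv`); a petal with `m_j = b` always has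
`βg_j ≤ a₀vv_j`.
This file: `mixed_step_one` (the two merged classes against `one_allowance_final`) and `normalised_bound_one` (the normalised
statement `∏ ψ(x_j,y_j) ≤ ψ(1,1)^(n−1)·(t + (1−t)V)`).  Part 2 (`…SunflowerCappedPendantOne`) un-normalises: `cappedPendant_of_one`,
`cappedPendant_of_one_free`, and the model corollary `res0_of_one_free`.
-/

noncomputable section

namespace Summit.CriticalPhenomena.PercolationContinuityZ3.Theorems.SunflowerPartition

namespace SafeCalc

namespace LinkedCurrency

open Finset Pendant

variable {κ : Type*}

/-- **The mixed step with one allowance**: a merged `u`-heavy petal `(XP, YP)` with `a₀·YP ≤ β·ZP` and a merged `g`-heavy petal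
`(XQ, YQ)` with `XQ ≤ ZQ` and the link `a₀YQ ≤ (1−s)bXQ + sβZQ`, sharing the budgets `b·XP·XQ ≤ 1`, `β·ZP·ZQ ≤ V`, contribute at
most one more factor `ψ(1,1)` times `t + (1−t)V`. [this work] -/
theorem mixed_step_one {b β s t V XP YP ZP XQ YQ ZQ AP AQ : ℝ} {kP kQ : ℕ} (hb : 0 < b) (hbβ : b ≤ β) (hs : 0 ≤ s)
    (hs1 : s ≤ 1) (ht : 0 ≤ t) (ht1 : t ≤ 1) (hXP : 1 ≤ XP) (hYP : 1 ≤ YP) (hZP : 1 ≤ ZP) (hXQ : 1 ≤ XQ) (hYQ : 1 ≤ YQ)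
    (hXYQ : XQ ≤ YQ) (hXZQ : XQ ≤ ZQ) (hbX : b * (XP * XQ) ≤ 1) (hβZ : β * (ZP * ZQ) ≤ V)
    (hallow : ((1 - s) * b + s * β) * YP ≤ β * ZP)
    (hlink : ((1 - s) * b + s * β) * YQ ≤ (1 - s) * b * XQ + s * β * ZQ) (hAP0 : 0 ≤ AP)
    (hAP : AP ≤ pfun (s * t) (t * (1 - s) * b) ((1 - t) * ((1 - s) * b + s * β)) 1 1 ^ kP *
      pfun (s * t) (t * (1 - s) * b) ((1 - t) * ((1 - s) * b + s * β)) XP YP)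
    (hAQ : AQ ≤ pfun (s * t) (t * (1 - s) * b) ((1 - t) * ((1 - s) * b + s * β)) 1 1 ^ kQ *
      pfun (s * t) (t * (1 - s) * b) ((1 - t) * ((1 - s) * b + s * β)) XQ YQ) :
    AP * AQ ≤ pfun (s * t) (t * (1 - s) * b) ((1 - t) * ((1 - s) * b + s * β)) 1 1 ^ (kP + kQ + 1) * (t + (1 - t) * V) := by
  set a₀ : ℝ := (1 - s) * b + s * β with ha₀
  set σ : ℝ := s * t with hσ
  set τ : ℝ := t * (1 - s) * b with hτ
  set ρ : ℝ := (1 - t) * a₀ with hρ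
  have hs' : 0 ≤ 1 - s := sub_nonneg.2 hs1
  have ht' : 0 ≤ 1 - t := sub_nonneg.2 ht1
  have hβ : 0 < β := hb.trans_le hbβ
  have ha₀b : b ≤ a₀ := by
    have := mul_le_mul_of_nonneg_left hbβ hs
    rw [ha₀]; linarith
  have ha₀pos : 0 < a₀ := hb.trans_le ha₀b
  have hσ0 : 0 ≤ σ := mul_nonneg hs ht
  have hτ0 : 0 ≤ τ := mul_nonneg (mul_nonneg ht hs') hb.le
  have hρ0 : 0 ≤ ρ := mul_nonneg ht' ha₀pos.le
  have hcnn : 0 ≤ pfun σ τ ρ 1 1 := pfun_nonneg hσ0 hτ0 hρ0 zero_le_one zero_le_one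
  have hXQpos : 0 < XQ := zero_lt_one.trans_le hXQ
  have hYQpos : 0 < YQ := zero_lt_one.trans_le hYQ
  have hZQpos : 0 < ZQ := zero_lt_one.trans_le (hXQ.trans hXZQ)
  -- the budgets of `one_allowance_final`
  have haYZ : a₀ * (YP * ZQ) ≤ V :=
    calc a₀ * (YP * ZQ) = (a₀ * YP) * ZQ := by ring
      _ ≤ (β * ZP) * ZQ := mul_le_mul_of_nonneg_right hallow hZQpos.le
      _ = β * (ZP * ZQ) := by ring
      _ ≤ V := hβZ
  have hβZQ : β * ZQ ≤ V :=
    calc β * ZQ = β * (1 * ZQ) := by ring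
      _ ≤ β * (ZP * ZQ) := mul_le_mul_of_nonneg_left (mul_le_mul_of_nonneg_right hZP hZQpos.le) hβ.le
      _ ≤ V := hβZ
  have hfin := one_allowance_final (V := V) hb hbβ hs hs1 ht ht1 hXP hXQ hXYQ hXZQ hbX haYZ hβZQ hlink
  simp only [← ha₀] at hfin
  rw [← hσ, ← hτ, ← hρ] at hfin
  have hQnn : 0 ≤ pfun σ τ ρ XQ YQ := pfun_nonneg hσ0 hτ0 hρ0 hXQpos.le hYQpos.le
  have hBnn : 0 ≤ pfun σ τ ρ 1 1 ^ kP * pfun σ τ ρ XP YP :=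
    mul_nonneg (pow_nonneg hcnn _) (pfun_nonneg hσ0 hτ0 hρ0 (zero_le_one.trans hXP) (zero_le_one.trans hYP))
  rcases le_or_gt 0 AQ with hAQ0 | hAQneg
  · calc AP * AQ ≤ (pfun σ τ ρ 1 1 ^ kP * pfun σ τ ρ XP YP) * (pfun σ τ ρ 1 1 ^ kQ * pfun σ τ ρ XQ YQ) :=
          mul_le_mul hAP hAQ hAQ0 hBnn
      _ = pfun σ τ ρ 1 1 ^ (kP + kQ) * (pfun σ τ ρ XP YP * pfun σ τ ρ XQ YQ) := by rw [pow_add]; ring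
      _ ≤ pfun σ τ ρ 1 1 ^ (kP + kQ) * (pfun σ τ ρ 1 1 * (t + (1 - t) * V)) :=
          mul_le_mul_of_nonneg_left hfin (pow_nonneg hcnn _)
      _ = pfun σ τ ρ 1 1 ^ (kP + kQ + 1) * (t + (1 - t) * V) := by rw [pow_succ]; ring
  · -- `AQ < 0`: the left side is `≤ 0`
    have h1 : AP * AQ ≤ 0 := mul_nonpos_of_nonneg_of_nonpos hAP0 hAQneg.le
    have hV : 0 ≤ t + (1 - t) * V := by
      have : 0 ≤ V := (mul_nonneg hβ.le hZQpos.le).trans hβZQ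
      positivity
    exact h1.trans (mul_nonneg (pow_nonneg hcnn _) hV)

/-- **The normalised bound with one allowance.**  For `n ≥ 1` and `x_j, y_j, z_j ≥ 1` with `b∏x ≤ 1`, `a₀∏y ≤ V`, `β∏z ≤ V`, the
links `x_j ≤ z_j ∧ a₀y_j ≤ lfun(x_j,z_j)` for every `g`-heavy `j` (`x_j < y_j`), the single-petal link `a₀y_j ≤ βz_j` for every `j`,
and `y_j ≤ z_j` for all `j` but at most one: `∏ ψ(x_j,y_j) ≤ ψ(1,1)^(n−1)·(t + (1−t)V)`. [this work] -/
theorem normalised_bound_one {n : ℕ} {b β s t V : ℝ} (hn : 0 < n) (hb : 0 < b) (hbβ : b ≤ β) (hs : 0 ≤ s) (hs1 : s ≤ 1)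
    (ht : 0 ≤ t) (ht1 : t ≤ 1) (x y z : Fin n → ℝ) (hx1 : ∀ j, 1 ≤ x j) (hy1 : ∀ j, 1 ≤ y j) (hz1 : ∀ j, 1 ≤ z j)
    (hPx : b * ∏ j, x j ≤ 1) (hPy : ((1 - s) * b + s * β) * ∏ j, y j ≤ V) (hPz : β * ∏ j, z j ≤ V)
    (hxz : ∀ j, x j < y j → x j ≤ z j)
    (hlink : ∀ j, x j < y j → ((1 - s) * b + s * β) * y j ≤ lfun b β s (x j) (z j))
    (hL2 : ∀ j, ((1 - s) * b + s * β) * y j ≤ β * z j) (hone : ∃ j₀, ∀ j, j ≠ j₀ → y j ≤ z j) :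
    ∏ j, pfun (s * t) (t * (1 - s) * b) ((1 - t) * ((1 - s) * b + s * β)) (x j) (y j) ≤
      pfun (s * t) (t * (1 - s) * b) ((1 - t) * ((1 - s) * b + s * β)) 1 1 ^ (n - 1) * (t + (1 - t) * V) := by
  classical
  set a₀ : ℝ := (1 - s) * b + s * β with ha₀
  set σ : ℝ := s * t with hσ
  set τ : ℝ := t * (1 - s) * b with hτ
  set ρ : ℝ := (1 - t) * a₀ with hρ
  have hs' : 0 ≤ 1 - s := sub_nonneg.2 hs1
  have ht' : 0 ≤ 1 - t := sub_nonneg.2 ht1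
  have hβpos : 0 < β := hb.trans_le hbβ
  have ha₀b : b ≤ a₀ := by
    have := mul_le_mul_of_nonneg_left hbβ hs
    rw [ha₀]; linarith
  have ha₀β : a₀ ≤ β := by
    have := mul_le_mul_of_nonneg_left hbβ hs'
    rw [ha₀]; linarith
  have ha₀pos : 0 < a₀ := hb.trans_le ha₀b
  have hσ0 : 0 ≤ σ := mul_nonneg hs ht
  have hτ0 : 0 ≤ τ := mul_nonneg (mul_nonneg ht hs') hb.le
  have hρ0 : 0 ≤ ρ := mul_nonneg ht' ha₀pos.le
  have hcnn : 0 ≤ pfun σ τ ρ 1 1 := pfun_nonneg hσ0 hτ0 hρ0 zero_le_one zero_le_one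
  have htop : pfun σ τ ρ (1 / b) (V / a₀) = t + (1 - t) * V := by
    simp only [pfun, hσ, hτ, hρ]; field_simp; ring
  have hVnn : 0 ≤ V := by
    have h1 : 0 ≤ β * ∏ j, z j := mul_nonneg hβpos.le (prod_nonneg fun j _ => zero_le_one.trans (hz1 j))
    exact h1.trans hPz
  -- the two classes of petals
  set P : Finset (Fin n) := univ.filter (fun j => y j ≤ x j) with hP
  set Q : Finset (Fin n) := univ.filter (fun j => ¬ (y j ≤ x j)) with hQ
  have hsplitF : ∏ j, pfun σ τ ρ (x j) (y j) = (∏ j ∈ P, pfun σ τ ρ (x j) (y j)) * ∏ j ∈ Q, pfun σ τ ρ (x j) (y j) :=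
    (prod_filter_mul_prod_filter_not univ _ _).symm
  have hsplitx : ∏ j, x j = (∏ j ∈ P, x j) * ∏ j ∈ Q, x j := (prod_filter_mul_prod_filter_not univ _ _).symm
  have hsplity : ∏ j, y j = (∏ j ∈ P, y j) * ∏ j ∈ Q, y j := (prod_filter_mul_prod_filter_not univ _ _).symm
  have hsplitz : ∏ j, z j = (∏ j ∈ P, z j) * ∏ j ∈ Q, z j := (prod_filter_mul_prod_filter_not univ _ _).symm
  have hcardPQ : P.card + Q.card = n := by
    rw [hP, hQ, Finset.card_filter_add_card_filter_not, card_univ, Fintype.card_fin]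
  have hXP1 : 1 ≤ ∏ j ∈ P, x j := one_le_prod_of_one_le P fun j _ => hx1 j
  have hYP1 : 1 ≤ ∏ j ∈ P, y j := one_le_prod_of_one_le P fun j _ => hy1 j
  have hZP1 : 1 ≤ ∏ j ∈ P, z j := one_le_prod_of_one_le P fun j _ => hz1 j
  have hXQ1 : 1 ≤ ∏ j ∈ Q, x j := one_le_prod_of_one_le Q fun j _ => hx1 j
  have hYQ1 : 1 ≤ ∏ j ∈ Q, y j := one_le_prod_of_one_le Q fun j _ => hy1 j
  have hZQ1 : 1 ≤ ∏ j ∈ Q, z j := one_le_prod_of_one_le Q fun j _ => hz1 j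
  have hQlt : ∀ j ∈ Q, x j < y j := fun j hj => not_le.1 (mem_filter.1 hj).2
  -- the total bounds
  have hXle : ∏ j, x j ≤ 1 / b := by rw [le_div_iff₀ hb, mul_comm]; exact hPx
  have hYle : ∏ j, y j ≤ V / a₀ := by rw [le_div_iff₀ ha₀pos, mul_comm]; exact hPy
  -- merged bounds for the two classes
  have hPm : P.Nonempty → ∏ j ∈ P, pfun σ τ ρ (x j) (y j) ≤
      pfun σ τ ρ 1 1 ^ (P.card - 1) * pfun σ τ ρ (∏ j ∈ P, x j) (∏ j ∈ P, y j) := fun hPn =>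
    prod_pfun_le_merged hσ0 hτ0 hρ0 x y P hPn (fun j _ => hy1 j) (fun j hj => (mem_filter.1 hj).2)
  have hQm : Q.Nonempty → ∏ j ∈ Q, pfun σ τ ρ (x j) (y j) ≤
      pfun σ τ ρ 1 1 ^ (Q.card - 1) * pfun σ τ ρ (∏ j ∈ Q, x j) (∏ j ∈ Q, y j) := fun hQn =>
    prod_pfun_le_merged' hσ0 hτ0 hρ0 x y Q hQn (fun j _ => hx1 j) (fun j hj => (hQlt j hj).le)
  rw [hsplitF]
  rcases Q.eq_empty_or_nonempty with hQe | hQn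
  · -- no g-heavy petal
    have hQc0 : Q.card = 0 := by rw [hQe, card_empty]
    have hPn : P.Nonempty := by rw [← Finset.card_pos]; omega
    have hPc : P.card = n := by omega
    rw [hQe, prod_empty, mul_one]
    refine (hPm hPn).trans ?_
    rw [hPc]
    rw [hQe, prod_empty, mul_one] at hsplitx hsplity
    rw [hsplitx] at hXle
    rw [hsplity] at hYle
    calc pfun σ τ ρ 1 1 ^ (n - 1) * pfun σ τ ρ (∏ j ∈ P, x j) (∏ j ∈ P, y j)
        ≤ pfun σ τ ρ 1 1 ^ (n - 1) * pfun σ τ ρ (1 / b) (V / a₀) :=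
          mul_le_mul_of_nonneg_left (pfun_mono hτ0 hρ0 hXle hYle) (pow_nonneg hcnn _)
      _ = pfun σ τ ρ 1 1 ^ (n - 1) * (t + (1 - t) * V) := by rw [htop]
  rcases P.eq_empty_or_nonempty with hPe | hPn
  · -- no u-heavy petal
    have hPc0 : P.card = 0 := by rw [hPe, card_empty]
    have hQc : Q.card = n := by omega
    rw [hPe, prod_empty, one_mul]
    refine (hQm hQn).trans ?_
    rw [hQc]
    rw [hPe, prod_empty, one_mul] at hsplitx hsplity
    rw [hsplitx] at hXle
    rw [hsplity] at hYle
    calc pfun σ τ ρ 1 1 ^ (n - 1) * pfun σ τ ρ (∏ j ∈ Q, x j) (∏ j ∈ Q, y j)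
        ≤ pfun σ τ ρ 1 1 ^ (n - 1) * pfun σ τ ρ (1 / b) (V / a₀) :=
          mul_le_mul_of_nonneg_left (pfun_mono hτ0 hρ0 hXle hYle) (pow_nonneg hcnn _)
      _ = pfun σ τ ρ 1 1 ^ (n - 1) * (t + (1 - t) * V) := by rw [htop]
  -- both classes nonempty: the budgets
  set XP : ℝ := ∏ j ∈ P, x j with hXP
  set YP : ℝ := ∏ j ∈ P, y j with hYP
  set ZP : ℝ := ∏ j ∈ P, z j with hZP
  set XQ : ℝ := ∏ j ∈ Q, x j with hXQ
  set YQ : ℝ := ∏ j ∈ Q, y j with hYQ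
  set ZQ : ℝ := ∏ j ∈ Q, z j with hZQ
  have hbX : b * (XP * XQ) ≤ 1 := by rw [← hsplitx]; exact hPx
  have hβZ : β * (ZP * ZQ) ≤ V := by rw [← hsplitz]; exact hPz
  -- the allowance for the merged u-heavy petal: `a₀ YP ≤ β ZP`
  have hallow : a₀ * YP ≤ β * ZP := by
    obtain ⟨j₀, hj₀⟩ := hone
    by_cases hmem : j₀ ∈ P
    · have eY : YP = y j₀ * ∏ j ∈ P.erase j₀, y j := by rw [hYP, mul_prod_erase P y hmem]
      have eZ : ZP = z j₀ * ∏ j ∈ P.erase j₀, z j := by rw [hZP, mul_prod_erase P z hmem]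
      have h1 : ∏ j ∈ P.erase j₀, y j ≤ ∏ j ∈ P.erase j₀, z j :=
        prod_le_prod (fun j _ => zero_le_one.trans (hy1 j)) fun j hj => hj₀ j (ne_of_mem_erase hj)
      have h0 : 0 ≤ ∏ j ∈ P.erase j₀, y j := prod_nonneg fun j _ => zero_le_one.trans (hy1 j)
      rw [eY, eZ]
      calc a₀ * (y j₀ * ∏ j ∈ P.erase j₀, y j) = (a₀ * y j₀) * ∏ j ∈ P.erase j₀, y j := by ring
        _ ≤ (β * z j₀) * ∏ j ∈ P.erase j₀, z j :=
            mul_le_mul (hL2 j₀) h1 h0 (mul_nonneg hβpos.le (zero_le_one.trans (hz1 j₀)))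
        _ = β * (z j₀ * ∏ j ∈ P.erase j₀, z j) := by ring
    · have h1 : YP ≤ ZP :=
        prod_le_prod (fun j _ => zero_le_one.trans (hy1 j)) fun j hj =>
          hj₀ j (fun h => hmem (h ▸ hj))
      calc a₀ * YP ≤ a₀ * ZP := mul_le_mul_of_nonneg_left h1 ha₀pos.le
        _ ≤ β * ZP := mul_le_mul_of_nonneg_right ha₀β (zero_le_one.trans hZP1)
  -- the link for the merged g-heavy petal
  have hlinkQ : a₀ * YQ ≤ (1 - s) * b * XQ + s * β * ZQ := by
    have h1 := prod_lfun_le hb.le hβpos.le hs hs1 x z Q hQn (fun j _ => hx1 j) (fun j hj => hxz j (hQlt j hj))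
    rw [← ha₀, ← hXQ, ← hZQ] at h1
    have h2 : ∏ j ∈ Q, (a₀ * y j) ≤ ∏ j ∈ Q, lfun b β s (x j) (z j) :=
      prod_le_prod (fun j _ => mul_nonneg ha₀pos.le (zero_le_one.trans (hy1 j))) fun j hj => hlink j (hQlt j hj)
    rw [prod_mul_distrib, prod_const, ← hYQ] at h2
    have hpow' : a₀ ^ Q.card = a₀ ^ (Q.card - 1) * a₀ := by
      rw [← pow_succ]; congr 1; have := hQn.card_pos; omega
    have h3 : a₀ ^ (Q.card - 1) * (a₀ * YQ) ≤ a₀ ^ (Q.card - 1) * lfun b β s XQ ZQ := by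
      rw [← mul_assoc, ← hpow']; exact h2.trans h1
    have h4 : a₀ * YQ ≤ lfun b β s XQ ZQ := le_of_mul_le_mul_left h3 (pow_pos ha₀pos _)
    simp only [lfun] at h4
    exact h4
  have hXYQ : XQ ≤ YQ := prod_le_prod (fun j _ => zero_le_one.trans (hx1 j)) fun j hj => (hQlt j hj).le
  have hXZQ : XQ ≤ ZQ := prod_le_prod (fun j _ => zero_le_one.trans (hx1 j)) fun j hj => hxz j (hQlt j hj)
  -- assemble with the mixed step
  have hcard : (P.card - 1) + (Q.card - 1) + 1 = n - 1 := by
    have := hPn.card_pos; have := hQn.card_pos; omega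
  have hAP0 : 0 ≤ ∏ j ∈ P, pfun σ τ ρ (x j) (y j) :=
    prod_nonneg fun j _ => pfun_nonneg hσ0 hτ0 hρ0 (zero_le_one.trans (hx1 j)) (zero_le_one.trans (hy1 j))
  rw [← hcard]
  exact mixed_step_one hb hbβ hs hs1 ht ht1 hXP1 hYP1 hZP1 hXQ1 hYQ1 hXYQ hXZQ hbX hβZ hallow hlinkQ hAP0
    (hPm hPn) (hQm hQn)

end LinkedCurrency

end SafeCalc

end Summit.CriticalPhenomena.PercolationContinuityZ3.Theorems.SunflowerPartition
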